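import Summits.RiemannHypothesis.RiemannHypothesis.Theorems.WeilTwoPrimeDeflM80XBase
import Summits.RiemannHypothesis.RiemannHypothesis.Theorems.WeilTwoPrimeDeflM80XDataPE10
import Literature.NumberTheory.LFunctions.WeilBlockRowsPZ
import Literature.NumberTheory.LFunctions.WeilBlockRowsFast
import Summits.RiemannHypothesis.RiemannHypothesis.Theorems.WeilTwoPrimeDeflM80PDataDnE18
import HarnessLib

/-!
# Calibration certificate M80X: dominance of rows 5–9 of `R = S''_even(κ') − UᵀU` (factored data, fast rows)

`WeilCert.checkDomRowF` + `checkDomRowPZ_of_F` with the materialized augmented block, M80P's factored inverse `weilCertDeflM80XDnE/weilCertDeflM80PLsE` and the Bessel block, by `decide +kernel` row by row. Pure proof file.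
-/

set_option linter.dupNamespace false

noncomputable section

namespace Summit.RiemannHypothesis.RiemannHypothesis.Theorems.EvenWinsBeyondArch

open Literature.NumberTheory.LFunctions

set_option maxHeartbeats 0 in
/-- Kernel check of the dominance of row 5 of `R` in the fast form `checkDomRowF` (even block, certificate M80X). [folklore] -/
theorem checkDomRowF0_5_weilCertDeflM80X :
    weilCertDeflM80XBase.checkDomRowF weilCertDeflM80XPmE weilCertDeflM80XDnE weilCertDeflM80PLsE weilCertDeflM80XHpE weilCertDeflM80XKappa' 0 5 = true := by
  decide +kernel

/-- Kernel check of the dominance of row 5 of `R` (even block, certificate M80X), from the fast row. [folklore] -/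
theorem checkDomRowPZ0_5_weilCertDeflM80X :
    weilCertDeflM80XBase.checkDomRowPZ weilCertDeflM80XPmE weilCertDeflM80XDnE weilCertDeflM80PLsE weilCertDeflM80XHpE weilCertDeflM80XKappa' 0 5 = true :=
  WeilCert.checkDomRowPZ_of_F (by decide) checkDomRowF0_5_weilCertDeflM80X

set_option maxHeartbeats 0 in
/-- Kernel check of the dominance of row 6 of `R` in the fast form `checkDomRowF` (even block, certificate M80X). [folklore] -/
theorem checkDomRowF0_6_weilCertDeflM80X :
    weilCertDeflM80XBase.checkDomRowF weilCertDeflM80XPmE weilCertDeflM80XDnE weilCertDeflM80PLsE weilCertDeflM80XHpE weilCertDeflM80XKappa' 0 6 = true := by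
  decide +kernel

/-- Kernel check of the dominance of row 6 of `R` (even block, certificate M80X), from the fast row. [folklore] -/
theorem checkDomRowPZ0_6_weilCertDeflM80X :
    weilCertDeflM80XBase.checkDomRowPZ weilCertDeflM80XPmE weilCertDeflM80XDnE weilCertDeflM80PLsE weilCertDeflM80XHpE weilCertDeflM80XKappa' 0 6 = true :=
  WeilCert.checkDomRowPZ_of_F (by decide) checkDomRowF0_6_weilCertDeflM80X

set_option maxHeartbeats 0 in
/-- Kernel check of the dominance of row 7 of `R` in the fast form `checkDomRowF` (even block, certificate M80X). [folklore] -/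
theorem checkDomRowF0_7_weilCertDeflM80X :
    weilCertDeflM80XBase.checkDomRowF weilCertDeflM80XPmE weilCertDeflM80XDnE weilCertDeflM80PLsE weilCertDeflM80XHpE weilCertDeflM80XKappa' 0 7 = true := by
  decide +kernel

/-- Kernel check of the dominance of row 7 of `R` (even block, certificate M80X), from the fast row. [folklore] -/
theorem checkDomRowPZ0_7_weilCertDeflM80X :
    weilCertDeflM80XBase.checkDomRowPZ weilCertDeflM80XPmE weilCertDeflM80XDnE weilCertDeflM80PLsE weilCertDeflM80XHpE weilCertDeflM80XKappa' 0 7 = true :=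
  WeilCert.checkDomRowPZ_of_F (by decide) checkDomRowF0_7_weilCertDeflM80X

set_option maxHeartbeats 0 in
/-- Kernel check of the dominance of row 8 of `R` in the fast form `checkDomRowF` (even block, certificate M80X). [folklore] -/
theorem checkDomRowF0_8_weilCertDeflM80X :
    weilCertDeflM80XBase.checkDomRowF weilCertDeflM80XPmE weilCertDeflM80XDnE weilCertDeflM80PLsE weilCertDeflM80XHpE weilCertDeflM80XKappa' 0 8 = true := by
  decide +kernel

/-- Kernel check of the dominance of row 8 of `R` (even block, certificate M80X), from the fast row. [folklore] -/
theorem checkDomRowPZ0_8_weilCertDeflM80X :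
    weilCertDeflM80XBase.checkDomRowPZ weilCertDeflM80XPmE weilCertDeflM80XDnE weilCertDeflM80PLsE weilCertDeflM80XHpE weilCertDeflM80XKappa' 0 8 = true :=
  WeilCert.checkDomRowPZ_of_F (by decide) checkDomRowF0_8_weilCertDeflM80X

set_option maxHeartbeats 0 in
/-- Kernel check of the dominance of row 9 of `R` in the fast form `checkDomRowF` (even block, certificate M80X). [folklore] -/
theorem checkDomRowF0_9_weilCertDeflM80X :
    weilCertDeflM80XBase.checkDomRowF weilCertDeflM80XPmE weilCertDeflM80XDnE weilCertDeflM80PLsE weilCertDeflM80XHpE weilCertDeflM80XKappa' 0 9 = true := by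
  decide +kernel

/-- Kernel check of the dominance of row 9 of `R` (even block, certificate M80X), from the fast row. [folklore] -/
theorem checkDomRowPZ0_9_weilCertDeflM80X :
    weilCertDeflM80XBase.checkDomRowPZ weilCertDeflM80XPmE weilCertDeflM80XDnE weilCertDeflM80PLsE weilCertDeflM80XHpE weilCertDeflM80XKappa' 0 9 = true :=
  WeilCert.checkDomRowPZ_of_F (by decide) checkDomRowF0_9_weilCertDeflM80X

end Summit.RiemannHypothesis.RiemannHypothesis.Theorems.EvenWinsBeyondArch

end
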